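import Mathlib
import Literature.Computability.Complexity.CircuitClassesProofs
import Summits.PneNP.PneNP.Theorems.KarlinRubinMonotoneSufficesShiftHybrid
import Summits.PneNP.PneNP.Theorems.KarlinRubinMonotoneSufficesShiftCollision
import Summits.PneNP.PneNP.Theorems.KarlinRubinMonotoneSufficesShiftRecMaj

/-!
# Crux `MonotoneSuffices` (stmt-PneNP-18026), line `Sketch` — scope of the SHIFT lever, part 3:
# recursive majority resists every shift (the induction and the assembly)

The coin: `RM[h, y]`, the depth-`h` RECURSIVE MAJORITY-OF-THREE of the `3^h` bits
`y : (Fin h → Fin 3) → Bool` (the tree's `recMaj` of `CircuitClassesProofs` with the leaf verdict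
"read the coin"), a read-once monotone formula of size `O(3^h)` and an exact two-sided coin
(`two_mul_card_recMaj_true`: exactly half of the cube accepts, by anti-self-duality).

* `card_gain_recMaj_mul_le` — **restricted influences are tiny**: on top of ANY upward restriction
  `y ↦ y ∨ 1_T`, forcing one more leaf gains at most `2^{3^h}/2^{h+1}` points of the cube
  (i.e. the restricted influence of every leaf is `≤ 2^{-h}`: a leaf is pivotal iff at each of its
  `h` ancestors the two sibling subtrees disagree, and an upward-restricted subtree is `1` with
  probability `≥ 1/2` — `two_mul_card_recMaj_upShift_ge` — so siblings disagree with probability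
  `≤ 1/2`, independently over the levels);
* **`recMaj_shiftResistant`** (registered helper sub-goal) — hence, by parts 1–2
  (`shift_hybrid`, `shift_collision`): every law on up-shifts `R` that enters `{RM = 1}` with
  probability `≥ 3/4` forces `≥ 2^h / 2` leaves on average and has collision number
  `∑ w i w j 2^{#(R_i ∩ R_j)} ≥ 2^{4^h/(4·3^h)}` — super-polynomial in the number of leaves
  `N' = 3^h` (`4^h/3^h = N'^{log₃ 4 - 1} = N'^{0.2618…}`).

So one negation of a recursive-majority coin is beyond every shift lever of the negation ladder
(evidence memo `session4-shift-levers.md`, §2): after `stub_shiftableLayer` the residue of rung 2 is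
exactly the coins of small restricted influence, and no further shift rung exists.
-/

set_option linter.dupNamespace false -- `Summit.PneNP.PneNP.…`: summit = sub-problem name (D-0017 single-conjunct layout)

namespace Summit.PneNP.PneNP.Theorems.MonotoneSuffices.ShiftNoGo

open Finset Literature.Computability.Complexity

/-! ### The induction: restricted acceptance `≥ 1/2`, restricted gains `≤ 2^{-h-1}` -/

/-- **Restricted recursive majority: acceptance at least half, gains at most `2^{3^k}/2^{k+1}`.** For
every upward restriction `T` of the leaves: (a) at least half of the leaf vectors `y` have
`RM(y ∨ 1_T) = 1`; (b) forcing one more leaf `e` gains at most `2^{3^k - k - 1}` leaf vectors.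
[folklore] -/
theorem recMaj_upShift_ind (k : ℕ) : ∀ T : Finset (Fin k → Fin 3),
    2 ^ 3 ^ k ≤ 2 * #((univ : Finset ((Fin k → Fin 3) → Bool)).filter fun y => (Literature.Computability.Complexity.recMaj (fun (_ : Unit → Bool) (ω : Unit → Bool) => ω ()) (k) (fun (_ : Unit) => false) (fun c (_ : Unit) => (y c || decide (c ∈ T)))) = true) ∧
    ∀ e : Fin k → Fin 3,
      #((univ : Finset ((Fin k → Fin 3) → Bool)).filter fun y =>
          (Literature.Computability.Complexity.recMaj (fun (_ : Unit → Bool) (ω : Unit → Bool) => ω ()) (k) (fun (_ : Unit) => false) (fun c (_ : Unit) => (y c || decide (c ∈ insert e T)))) = true ∧ (Literature.Computability.Complexity.recMaj (fun (_ : Unit → Bool) (ω : Unit → Bool) => ω ()) (k) (fun (_ : Unit) => false) (fun c (_ : Unit) => (y c || decide (c ∈ T)))) = false) * 2 ^ (k + 1) ≤ 2 ^ 3 ^ k := by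
  induction k with
  | zero =>
    intro T
    constructor
    · have hmem : (fun _ => true) ∈ (univ : Finset ((Fin 0 → Fin 3) → Bool)).filter fun y =>
          (Literature.Computability.Complexity.recMaj (fun (_ : Unit → Bool) (ω : Unit → Bool) => ω ()) (0) (fun (_ : Unit) => false) (fun c (_ : Unit) => (y c || decide (c ∈ T)))) = true := by
        rw [mem_filter]
        exact ⟨mem_univ _, rfl⟩
      have hpos := card_pos.2 ⟨_, hmem⟩
      have h1 : (2 : ℕ) ^ 3 ^ 0 = 2 := by norm_num
      rw [h1]
      omega
    · intro e
      have hle : #((univ : Finset ((Fin 0 → Fin 3) → Bool)).filter fun y =>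
          (Literature.Computability.Complexity.recMaj (fun (_ : Unit → Bool) (ω : Unit → Bool) => ω ()) (0) (fun (_ : Unit) => false) (fun c (_ : Unit) => (y c || decide (c ∈ insert e T)))) = true ∧ (Literature.Computability.Complexity.recMaj (fun (_ : Unit → Bool) (ω : Unit → Bool) => ω ()) (0) (fun (_ : Unit) => false) (fun c (_ : Unit) => (y c || decide (c ∈ T)))) = false) ≤ 1 := by
        refine card_le_one.2 fun y hy y' hy' => ?_
        rw [mem_filter] at hy hy'
        have h1 : y Fin.elim0 = false := by
          have h := hy.2.2
          change (y Fin.elim0 || decide ((Fin.elim0 : Fin 0 → Fin 3) ∈ T)) = false at h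
          revert h; cases y Fin.elim0 <;> simp
        have h2 : y' Fin.elim0 = false := by
          have h := hy'.2.2
          change (y' Fin.elim0 || decide ((Fin.elim0 : Fin 0 → Fin 3) ∈ T)) = false at h
          revert h; cases y' Fin.elim0 <;> simp
        funext a
        rw [Subsingleton.elim a Fin.elim0, h1, h2]
      have h1 : (2 : ℕ) ^ 3 ^ 0 = 2 := by norm_num
      rw [h1]
      omega
  | succ k ih =>
    intro T
    have hcardS := card_leaves k
    constructor
    · -- (a) transfer to the subtree triples
      have eAcc : #((univ : Finset ((Fin (k + 1) → Fin 3) → Bool)).filter fun y => (Literature.Computability.Complexity.recMaj (fun (_ : Unit → Bool) (ω : Unit → Bool) => ω ()) (k + 1) (fun (_ : Unit) => false) (fun c (_ : Unit) => (y c || decide (c ∈ T)))) = true) =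
          #((univ : Finset (Fin 3 → ((Fin k → Fin 3) → Bool))).filter fun θ => maj3 (Literature.Computability.Complexity.recMaj (fun (_ : Unit → Bool) (ω : Unit → Bool) => ω ()) (k) (fun (_ : Unit) => false) (fun c (_ : Unit) => ((θ 0) c || decide (c ∈ ((univ : Finset (Fin k → Fin 3)).filter fun c => (Fin.cons 0 c : Fin (k + 1) → Fin 3) ∈ T))))) (Literature.Computability.Complexity.recMaj (fun (_ : Unit → Bool) (ω : Unit → Bool) => ω ()) (k) (fun (_ : Unit) => false) (fun c (_ : Unit) => ((θ 1) c || decide (c ∈ ((univ : Finset (Fin k → Fin 3)).filter fun c => (Fin.cons 1 c : Fin (k + 1) → Fin 3) ∈ T))))) (Literature.Computability.Complexity.recMaj (fun (_ : Unit → Bool) (ω : Unit → Bool) => ω ()) (k) (fun (_ : Unit) => false) (fun c (_ : Unit) => ((θ 2) c || decide (c ∈ ((univ : Finset (Fin k → Fin 3)).filter fun c => (Fin.cons 2 c : Fin (k + 1) → Fin 3) ∈ T))))) = true) := by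
        rw [← card_filter_succ_eq k (fun θ => maj3 (Literature.Computability.Complexity.recMaj (fun (_ : Unit → Bool) (ω : Unit → Bool) => ω ()) (k) (fun (_ : Unit) => false) (fun c (_ : Unit) => ((θ 0) c || decide (c ∈ ((univ : Finset (Fin k → Fin 3)).filter fun c => (Fin.cons 0 c : Fin (k + 1) → Fin 3) ∈ T))))) (Literature.Computability.Complexity.recMaj (fun (_ : Unit → Bool) (ω : Unit → Bool) => ω ()) (k) (fun (_ : Unit) => false) (fun c (_ : Unit) => ((θ 1) c || decide (c ∈ ((univ : Finset (Fin k → Fin 3)).filter fun c => (Fin.cons 1 c : Fin (k + 1) → Fin 3) ∈ T))))) (Literature.Computability.Complexity.recMaj (fun (_ : Unit → Bool) (ω : Unit → Bool) => ω ()) (k) (fun (_ : Unit) => false) (fun c (_ : Unit) => ((θ 2) c || decide (c ∈ ((univ : Finset (Fin k → Fin 3)).filter fun c => (Fin.cons 2 c : Fin (k + 1) → Fin 3) ∈ T))))) = true)]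
        exact congrArg Finset.card (filter_congr fun y _ => by rw [recMaj_succ_upShift])
      -- the rejecting triples lie in three boxes
      have hsub : ((univ : Finset (Fin 3 → ((Fin k → Fin 3) → Bool))).filter fun θ => maj3 (Literature.Computability.Complexity.recMaj (fun (_ : Unit → Bool) (ω : Unit → Bool) => ω ()) (k) (fun (_ : Unit) => false) (fun c (_ : Unit) => ((θ 0) c || decide (c ∈ ((univ : Finset (Fin k → Fin 3)).filter fun c => (Fin.cons 0 c : Fin (k + 1) → Fin 3) ∈ T))))) (Literature.Computability.Complexity.recMaj (fun (_ : Unit → Bool) (ω : Unit → Bool) => ω ()) (k) (fun (_ : Unit) => false) (fun c (_ : Unit) => ((θ 1) c || decide (c ∈ ((univ : Finset (Fin k → Fin 3)).filter fun c => (Fin.cons 1 c : Fin (k + 1) → Fin 3) ∈ T))))) (Literature.Computability.Complexity.recMaj (fun (_ : Unit → Bool) (ω : Unit → Bool) => ω ()) (k) (fun (_ : Unit) => false) (fun c (_ : Unit) => ((θ 2) c || decide (c ∈ ((univ : Finset (Fin k → Fin 3)).filter fun c => (Fin.cons 2 c : Fin (k + 1) → Fin 3) ∈ T))))) = false) ⊆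
          Fintype.piFinset ![(((univ : Finset ((Fin k → Fin 3) → Bool)).filter fun s => (Literature.Computability.Complexity.recMaj (fun (_ : Unit → Bool) (ω : Unit → Bool) => ω ()) (k) (fun (_ : Unit) => false) (fun c (_ : Unit) => (s c || decide (c ∈ ((univ : Finset (Fin k → Fin 3)).filter fun c => (Fin.cons 0 c : Fin (k + 1) → Fin 3) ∈ T))))) = true))ᶜ, (((univ : Finset ((Fin k → Fin 3) → Bool)).filter fun s => (Literature.Computability.Complexity.recMaj (fun (_ : Unit → Bool) (ω : Unit → Bool) => ω ()) (k) (fun (_ : Unit) => false) (fun c (_ : Unit) => (s c || decide (c ∈ ((univ : Finset (Fin k → Fin 3)).filter fun c => (Fin.cons 1 c : Fin (k + 1) → Fin 3) ∈ T))))) = true))ᶜ, (univ : Finset ((Fin k → Fin 3) → Bool))] ∪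
            (Fintype.piFinset ![(((univ : Finset ((Fin k → Fin 3) → Bool)).filter fun s => (Literature.Computability.Complexity.recMaj (fun (_ : Unit → Bool) (ω : Unit → Bool) => ω ()) (k) (fun (_ : Unit) => false) (fun c (_ : Unit) => (s c || decide (c ∈ ((univ : Finset (Fin k → Fin 3)).filter fun c => (Fin.cons 0 c : Fin (k + 1) → Fin 3) ∈ T))))) = true))ᶜ, ((univ : Finset ((Fin k → Fin 3) → Bool)).filter fun s => (Literature.Computability.Complexity.recMaj (fun (_ : Unit → Bool) (ω : Unit → Bool) => ω ()) (k) (fun (_ : Unit) => false) (fun c (_ : Unit) => (s c || decide (c ∈ ((univ : Finset (Fin k → Fin 3)).filter fun c => (Fin.cons 1 c : Fin (k + 1) → Fin 3) ∈ T))))) = true), (((univ : Finset ((Fin k → Fin 3) → Bool)).filter fun s => (Literature.Computability.Complexity.recMaj (fun (_ : Unit → Bool) (ω : Unit → Bool) => ω ()) (k) (fun (_ : Unit) => false) (fun c (_ : Unit) => (s c || decide (c ∈ ((univ : Finset (Fin k → Fin 3)).filter fun c => (Fin.cons 2 c : Fin (k + 1) → Fin 3) ∈ T))))) = true))ᶜ]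 ∪
              Fintype.piFinset ![((univ : Finset ((Fin k → Fin 3) → Bool)).filter fun s => (Literature.Computability.Complexity.recMaj (fun (_ : Unit → Bool) (ω : Unit → Bool) => ω ()) (k) (fun (_ : Unit) => false) (fun c (_ : Unit) => (s c || decide (c ∈ ((univ : Finset (Fin k → Fin 3)).filter fun c => (Fin.cons 0 c : Fin (k + 1) → Fin 3) ∈ T))))) = true), (((univ : Finset ((Fin k → Fin 3) → Bool)).filter fun s => (Literature.Computability.Complexity.recMaj (fun (_ : Unit → Bool) (ω : Unit → Bool) => ω ()) (k) (fun (_ : Unit) => false) (fun c (_ : Unit) => (s c || decide (c ∈ ((univ : Finset (Fin k → Fin 3)).filter fun c => (Fin.cons 1 c : Fin (k + 1) → Fin 3) ∈ T))))) = true))ᶜ, (((univ : Finset ((Fin k → Fin 3) → Bool)).filter fun s => (Literature.Computability.Complexity.recMaj (fun (_ : Unit → Bool) (ω : Unit → Bool) => ω ()) (k) (fun (_ : Unit) => false) (fun c (_ : Unit) => (s c || decide (c ∈ ((univ : Finset (Fin k → Fin 3)).filter fun c => (Fin.cons 2 c : Fin (k + 1) → Fin 3) ∈ T))))) = true))ᶜ])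 := by
        intro θ hθ
        rw [mem_filter] at hθ
        have hc := maj3_false_cases _ _ _ hθ.2
        rw [mem_union, mem_union, mem_pi3, mem_pi3, mem_pi3]
        -- membership in the acceptance sets of the subtrees, read off the subtree values
        have nA0 : (Literature.Computability.Complexity.recMaj (fun (_ : Unit → Bool) (ω : Unit → Bool) => ω ()) (k) (fun (_ : Unit) => false) (fun c (_ : Unit) => ((θ 0) c || decide (c ∈ ((univ : Finset (Fin k → Fin 3)).filter fun c => (Fin.cons 0 c : Fin (k + 1) → Fin 3) ∈ T))))) = false → θ 0 ∈ (((univ : Finset ((Fin k → Fin 3) → Bool)).filter fun s => (Literature.Computability.Complexity.recMaj (fun (_ : Unit → Bool) (ω : Unit → Bool) => ω ()) (k) (fun (_ : Unit) => false) (fun c (_ : Unit) => (s c || decide (c ∈ ((univ : Finset (Fin k → Fin 3)).filter fun c => (Fin.cons 0 c : Fin (k + 1) → Fin 3) ∈ T))))) = true))ᶜ := fun h =>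
          mem_compl.2 fun hm => by
            have h' : (Literature.Computability.Complexity.recMaj (fun (_ : Unit → Bool) (ω : Unit → Bool) => ω ()) (k) (fun (_ : Unit) => false) (fun c (_ : Unit) => ((θ 0) c || decide (c ∈ ((univ : Finset (Fin k → Fin 3)).filter fun c => (Fin.cons 0 c : Fin (k + 1) → Fin 3) ∈ T))))) = true := (mem_filter.1 hm).2
            rw [h] at h'; exact Bool.false_ne_true h'
        have nA1 : (Literature.Computability.Complexity.recMaj (fun (_ : Unit → Bool) (ω : Unit → Bool) => ω ()) (k) (fun (_ : Unit) => false) (fun c (_ : Unit) => ((θ 1) c || decide (c ∈ ((univ : Finset (Fin k → Fin 3)).filter fun c => (Fin.cons 1 c : Fin (k + 1) → Fin 3) ∈ T))))) = false → θ 1 ∈ (((univ : Finset ((Fin k → Fin 3) → Bool)).filter fun s => (Literature.Computability.Complexity.recMaj (fun (_ : Unit → Bool) (ω : Unit → Bool) => ω ()) (k) (fun (_ : Unit) => false) (fun c (_ : Unit) => (s c || decide (c ∈ ((univ : Finset (Fin k → Fin 3)).filter fun c => (Fin.cons 1 c : Fin (k + 1) → Fin 3) ∈ T))))) = true))ᶜ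 := fun h =>
          mem_compl.2 fun hm => by
            have h' : (Literature.Computability.Complexity.recMaj (fun (_ : Unit → Bool) (ω : Unit → Bool) => ω ()) (k) (fun (_ : Unit) => false) (fun c (_ : Unit) => ((θ 1) c || decide (c ∈ ((univ : Finset (Fin k → Fin 3)).filter fun c => (Fin.cons 1 c : Fin (k + 1) → Fin 3) ∈ T))))) = true := (mem_filter.1 hm).2
            rw [h] at h'; exact Bool.false_ne_true h'
        have nA2 : (Literature.Computability.Complexity.recMaj (fun (_ : Unit → Bool) (ω : Unit → Bool) => ω ()) (k) (fun (_ : Unit) => false) (fun c (_ : Unit) => ((θ 2) c || decide (c ∈ ((univ : Finset (Fin k → Fin 3)).filter fun c => (Fin.cons 2 c : Fin (k + 1) → Fin 3) ∈ T))))) = false → θ 2 ∈ (((univ : Finset ((Fin k → Fin 3) → Bool)).filter fun s => (Literature.Computability.Complexity.recMaj (fun (_ : Unit → Bool) (ω : Unit → Bool) => ω ()) (k) (fun (_ : Unit) => false) (fun c (_ : Unit) => (s c || decide (c ∈ ((univ : Finset (Fin k → Fin 3)).filter fun c => (Fin.cons 2 c : Fin (k + 1) → Fin 3) ∈ T)))))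 = true))ᶜ := fun h =>
          mem_compl.2 fun hm => by
            have h' : (Literature.Computability.Complexity.recMaj (fun (_ : Unit → Bool) (ω : Unit → Bool) => ω ()) (k) (fun (_ : Unit) => false) (fun c (_ : Unit) => ((θ 2) c || decide (c ∈ ((univ : Finset (Fin k → Fin 3)).filter fun c => (Fin.cons 2 c : Fin (k + 1) → Fin 3) ∈ T))))) = true := (mem_filter.1 hm).2
            rw [h] at h'; exact Bool.false_ne_true h'
        have yA0 : (Literature.Computability.Complexity.recMaj (fun (_ : Unit → Bool) (ω : Unit → Bool) => ω ()) (k) (fun (_ : Unit) => false) (fun c (_ : Unit) => ((θ 0) c || decide (c ∈ ((univ : Finset (Fin k → Fin 3)).filter fun c => (Fin.cons 0 c : Fin (k + 1) → Fin 3) ∈ T))))) = true → θ 0 ∈ ((univ : Finset ((Fin k → Fin 3) → Bool)).filter fun s => (Literature.Computability.Complexity.recMaj (fun (_ : Unit → Bool) (ω : Unit → Bool) => ω ()) (k) (fun (_ : Unit) => false) (fun c (_ : Unit) => (s c || decide (c ∈ ((univ : Finset (Fin k → Fin 3)).filter fun c => (Fin.cons 0 c : Fin (k + 1) → Fin 3)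 ∈ T))))) = true) := fun h => mem_filter.2 ⟨mem_univ _, h⟩
        have yA1 : (Literature.Computability.Complexity.recMaj (fun (_ : Unit → Bool) (ω : Unit → Bool) => ω ()) (k) (fun (_ : Unit) => false) (fun c (_ : Unit) => ((θ 1) c || decide (c ∈ ((univ : Finset (Fin k → Fin 3)).filter fun c => (Fin.cons 1 c : Fin (k + 1) → Fin 3) ∈ T))))) = true → θ 1 ∈ ((univ : Finset ((Fin k → Fin 3) → Bool)).filter fun s => (Literature.Computability.Complexity.recMaj (fun (_ : Unit → Bool) (ω : Unit → Bool) => ω ()) (k) (fun (_ : Unit) => false) (fun c (_ : Unit) => (s c || decide (c ∈ ((univ : Finset (Fin k → Fin 3)).filter fun c => (Fin.cons 1 c : Fin (k + 1) → Fin 3) ∈ T))))) = true) := fun h => mem_filter.2 ⟨mem_univ _, h⟩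
        rcases hc with ⟨h0, h1⟩ | ⟨h0, h1, h2⟩ | ⟨h0, h1, h2⟩
        · exact Or.inl ⟨nA0 h0, nA1 h1, mem_univ _⟩
        · exact Or.inr (Or.inl ⟨nA0 h0, yA1 h1, nA2 h2⟩)
        · exact Or.inr (Or.inr ⟨yA0 h0, nA1 h1, nA2 h2⟩)
      have hRej := (card_le_card hsub).trans ((card_union_le _ _).trans
        (Nat.add_le_add_left (card_union_le _ _) _))
      rw [card_pi3, card_pi3, card_pi3, card_compl, card_compl, card_compl, card_univ, hcardS] at hRej
      have htot := card_filter_add_card_filter_not (s := (univ : Finset (Fin 3 → ((Fin k → Fin 3) → Bool))))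
        (fun θ => maj3 (Literature.Computability.Complexity.recMaj (fun (_ : Unit → Bool) (ω : Unit → Bool) => ω ()) (k) (fun (_ : Unit) => false) (fun c (_ : Unit) => ((θ 0) c || decide (c ∈ ((univ : Finset (Fin k → Fin 3)).filter fun c => (Fin.cons 0 c : Fin (k + 1) → Fin 3) ∈ T))))) (Literature.Computability.Complexity.recMaj (fun (_ : Unit → Bool) (ω : Unit → Bool) => ω ()) (k) (fun (_ : Unit) => false) (fun c (_ : Unit) => ((θ 1) c || decide (c ∈ ((univ : Finset (Fin k → Fin 3)).filter fun c => (Fin.cons 1 c : Fin (k + 1) → Fin 3) ∈ T))))) (Literature.Computability.Complexity.recMaj (fun (_ : Unit → Bool) (ω : Unit → Bool) => ω ()) (k) (fun (_ : Unit) => false) (fun c (_ : Unit) => ((θ 2) c || decide (c ∈ ((univ : Finset (Fin k → Fin 3)).filter fun c => (Fin.cons 2 c : Fin (k + 1) → Fin 3) ∈ T))))) = true)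
      rw [card_univ, Fintype.card_fun, Fintype.card_fin, hcardS] at htot
      have hneg : #((univ : Finset (Fin 3 → ((Fin k → Fin 3) → Bool))).filter fun θ => ¬ maj3 (Literature.Computability.Complexity.recMaj (fun (_ : Unit → Bool) (ω : Unit → Bool) => ω ()) (k) (fun (_ : Unit) => false) (fun c (_ : Unit) => ((θ 0) c || decide (c ∈ ((univ : Finset (Fin k → Fin 3)).filter fun c => (Fin.cons 0 c : Fin (k + 1) → Fin 3) ∈ T))))) (Literature.Computability.Complexity.recMaj (fun (_ : Unit → Bool) (ω : Unit → Bool) => ω ()) (k) (fun (_ : Unit) => false) (fun c (_ : Unit) => ((θ 1) c || decide (c ∈ ((univ : Finset (Fin k → Fin 3)).filter fun c => (Fin.cons 1 c : Fin (k + 1) → Fin 3) ∈ T))))) (Literature.Computability.Complexity.recMaj (fun (_ : Unit → Bool) (ω : Unit → Bool) => ω ()) (k) (fun (_ : Unit) => false) (fun c (_ : Unit) => ((θ 2) c || decide (c ∈ ((univ : Finset (Fin k → Fin 3)).filter fun c => (Fin.cons 2 c : Fin (k + 1) → Fin 3) ∈ T))))) = true) =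
          #((univ : Finset (Fin 3 → ((Fin k → Fin 3) → Bool))).filter fun θ => maj3 (Literature.Computability.Complexity.recMaj (fun (_ : Unit → Bool) (ω : Unit → Bool) => ω ()) (k) (fun (_ : Unit) => false) (fun c (_ : Unit) => ((θ 0) c || decide (c ∈ ((univ : Finset (Fin k → Fin 3)).filter fun c => (Fin.cons 0 c : Fin (k + 1) → Fin 3) ∈ T))))) (Literature.Computability.Complexity.recMaj (fun (_ : Unit → Bool) (ω : Unit → Bool) => ω ()) (k) (fun (_ : Unit) => false) (fun c (_ : Unit) => ((θ 1) c || decide (c ∈ ((univ : Finset (Fin k → Fin 3)).filter fun c => (Fin.cons 1 c : Fin (k + 1) → Fin 3) ∈ T))))) (Literature.Computability.Complexity.recMaj (fun (_ : Unit → Bool) (ω : Unit → Bool) => ω ()) (k) (fun (_ : Unit) => false) (fun c (_ : Unit) => ((θ 2) c || decide (c ∈ ((univ : Finset (Fin k → Fin 3)).filter fun c => (Fin.cons 2 c : Fin (k + 1) → Fin 3) ∈ T))))) = false) :=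
        congrArg Finset.card (filter_congr fun θ _ => by simp)
      rw [hneg] at htot
      have h0 := (ih ((univ : Finset (Fin k → Fin 3)).filter fun c => (Fin.cons 0 c : Fin (k + 1) → Fin 3) ∈ T)).1
      have h1 := (ih ((univ : Finset (Fin k → Fin 3)).filter fun c => (Fin.cons 1 c : Fin (k + 1) → Fin 3) ∈ T)).1
      have h2 := (ih ((univ : Finset (Fin k → Fin 3)).filter fun c => (Fin.cons 2 c : Fin (k + 1) → Fin 3) ∈ T)).1
      have ha0 : #((univ : Finset ((Fin k → Fin 3) → Bool)).filter fun s => (Literature.Computability.Complexity.recMaj (fun (_ : Unit → Bool) (ω : Unit → Bool) => ω ()) (k) (fun (_ : Unit) => false) (fun c (_ : Unit) => (s c || decide (c ∈ ((univ : Finset (Fin k → Fin 3)).filter fun c => (Fin.cons 0 c : Fin (k + 1) → Fin 3) ∈ T))))) = true) ≤ 2 ^ 3 ^ k := by rw [← hcardS]; exact card_le_univ _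
      have ha1 : #((univ : Finset ((Fin k → Fin 3) → Bool)).filter fun s => (Literature.Computability.Complexity.recMaj (fun (_ : Unit → Bool) (ω : Unit → Bool) => ω ()) (k) (fun (_ : Unit) => false) (fun c (_ : Unit) => (s c || decide (c ∈ ((univ : Finset (Fin k → Fin 3)).filter fun c => (Fin.cons 1 c : Fin (k + 1) → Fin 3) ∈ T))))) = true) ≤ 2 ^ 3 ^ k := by rw [← hcardS]; exact card_le_univ _
      have ha2 : #((univ : Finset ((Fin k → Fin 3) → Bool)).filter fun s => (Literature.Computability.Complexity.recMaj (fun (_ : Unit → Bool) (ω : Unit → Bool) => ω ()) (k) (fun (_ : Unit) => false) (fun c (_ : Unit) => (s c || decide (c ∈ ((univ : Finset (Fin k → Fin 3)).filter fun c => (Fin.cons 2 c : Fin (k + 1) → Fin 3) ∈ T))))) = true) ≤ 2 ^ 3 ^ k := by rw [← hcardS]; exact card_le_univ _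
      -- the arithmetic of three independent bits (in `ℝ`)
      have hrej : 2 * ((2 ^ 3 ^ k - #((univ : Finset ((Fin k → Fin 3) → Bool)).filter fun s => (Literature.Computability.Complexity.recMaj (fun (_ : Unit → Bool) (ω : Unit → Bool) => ω ()) (k) (fun (_ : Unit) => false) (fun c (_ : Unit) => (s c || decide (c ∈ ((univ : Finset (Fin k → Fin 3)).filter fun c => (Fin.cons 0 c : Fin (k + 1) → Fin 3) ∈ T))))) = true)) * (2 ^ 3 ^ k - #((univ : Finset ((Fin k → Fin 3) → Bool)).filter fun s => (Literature.Computability.Complexity.recMaj (fun (_ : Unit → Bool) (ω : Unit → Bool) => ω ()) (k) (fun (_ : Unit) => false) (fun c (_ : Unit) => (s c || decide (c ∈ ((univ : Finset (Fin k → Fin 3)).filter fun c => (Fin.cons 1 c : Fin (k + 1) → Fin 3) ∈ T))))) = true)) * 2 ^ 3 ^ k +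
          (2 ^ 3 ^ k - #((univ : Finset ((Fin k → Fin 3) → Bool)).filter fun s => (Literature.Computability.Complexity.recMaj (fun (_ : Unit → Bool) (ω : Unit → Bool) => ω ()) (k) (fun (_ : Unit) => false) (fun c (_ : Unit) => (s c || decide (c ∈ ((univ : Finset (Fin k → Fin 3)).filter fun c => (Fin.cons 0 c : Fin (k + 1) → Fin 3) ∈ T))))) = true)) * #((univ : Finset ((Fin k → Fin 3) → Bool)).filter fun s => (Literature.Computability.Complexity.recMaj (fun (_ : Unit → Bool) (ω : Unit → Bool) => ω ()) (k) (fun (_ : Unit) => false) (fun c (_ : Unit) => (s c || decide (c ∈ ((univ : Finset (Fin k → Fin 3)).filter fun c => (Fin.cons 1 c : Fin (k + 1) → Fin 3) ∈ T))))) = true) * (2 ^ 3 ^ k - #((univ : Finset ((Fin k → Fin 3) → Bool)).filter fun s => (Literature.Computability.Complexity.recMaj (fun (_ : Unit → Bool) (ω : Unit → Bool) => ω ()) (k) (fun (_ : Unit) => false) (fun c (_ : Unit) => (s c || decide (c ∈ ((univ : Finset (Fin k → Fin 3)).filter fun c => (Fin.cons 2 c : Fin (k + 1) → Fin 3) ∈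 T))))) = true)) +
          #((univ : Finset ((Fin k → Fin 3) → Bool)).filter fun s => (Literature.Computability.Complexity.recMaj (fun (_ : Unit → Bool) (ω : Unit → Bool) => ω ()) (k) (fun (_ : Unit) => false) (fun c (_ : Unit) => (s c || decide (c ∈ ((univ : Finset (Fin k → Fin 3)).filter fun c => (Fin.cons 0 c : Fin (k + 1) → Fin 3) ∈ T))))) = true) * (2 ^ 3 ^ k - #((univ : Finset ((Fin k → Fin 3) → Bool)).filter fun s => (Literature.Computability.Complexity.recMaj (fun (_ : Unit → Bool) (ω : Unit → Bool) => ω ()) (k) (fun (_ : Unit) => false) (fun c (_ : Unit) => (s c || decide (c ∈ ((univ : Finset (Fin k → Fin 3)).filter fun c => (Fin.cons 1 c : Fin (k + 1) → Fin 3) ∈ T))))) = true)) * (2 ^ 3 ^ k - #((univ : Finset ((Fin k → Fin 3) → Bool)).filter fun s => (Literature.Computability.Complexity.recMaj (fun (_ : Unit → Bool) (ω : Unit → Bool) => ω ()) (k) (fun (_ : Unit) => false) (fun c (_ : Unit) => (s c || decide (c ∈ ((univ : Finset (Fin k → Fin 3)).filter fun c => (Fin.cons 2 c : Fin (k + 1)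 → Fin 3) ∈ T))))) = true))) ≤ 2 ^ 3 ^ k * 2 ^ 3 ^ k * 2 ^ 3 ^ k := by
        have hr := two_mul_rej_le (M := ((2 ^ 3 ^ k : ℕ) : ℝ))
          (a0 := (#((univ : Finset ((Fin k → Fin 3) → Bool)).filter fun s => (Literature.Computability.Complexity.recMaj (fun (_ : Unit → Bool) (ω : Unit → Bool) => ω ()) (k) (fun (_ : Unit) => false) (fun c (_ : Unit) => (s c || decide (c ∈ ((univ : Finset (Fin k → Fin 3)).filter fun c => (Fin.cons 0 c : Fin (k + 1) → Fin 3) ∈ T))))) = true) : ℝ)) (a1 := (#((univ : Finset ((Fin k → Fin 3) → Bool)).filter fun s => (Literature.Computability.Complexity.recMaj (fun (_ : Unit → Bool) (ω : Unit → Bool) => ω ()) (k) (fun (_ : Unit) => false) (fun c (_ : Unit) => (s c || decide (c ∈ ((univ : Finset (Fin k → Fin 3)).filter fun c => (Fin.cons 1 c : Fin (k + 1) → Fin 3) ∈ T))))) = true) : ℝ))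
          (b0 := (((2 ^ 3 ^ k - #((univ : Finset ((Fin k → Fin 3) → Bool)).filter fun s => (Literature.Computability.Complexity.recMaj (fun (_ : Unit → Bool) (ω : Unit → Bool) => ω ()) (k) (fun (_ : Unit) => false) (fun c (_ : Unit) => (s c || decide (c ∈ ((univ : Finset (Fin k → Fin 3)).filter fun c => (Fin.cons 0 c : Fin (k + 1) → Fin 3) ∈ T))))) = true) : ℕ)) : ℝ)) (b1 := (((2 ^ 3 ^ k - #((univ : Finset ((Fin k → Fin 3) → Bool)).filter fun s => (Literature.Computability.Complexity.recMaj (fun (_ : Unit → Bool) (ω : Unit → Bool) => ω ()) (k) (fun (_ : Unit) => false) (fun c (_ : Unit) => (s c || decide (c ∈ ((univ : Finset (Fin k → Fin 3)).filter fun c => (Fin.cons 1 c : Fin (k + 1) → Fin 3) ∈ T))))) = true) : ℕ)) : ℝ))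
          (b2 := (((2 ^ 3 ^ k - #((univ : Finset ((Fin k → Fin 3) → Bool)).filter fun s => (Literature.Computability.Complexity.recMaj (fun (_ : Unit → Bool) (ω : Unit → Bool) => ω ()) (k) (fun (_ : Unit) => false) (fun c (_ : Unit) => (s c || decide (c ∈ ((univ : Finset (Fin k → Fin 3)).filter fun c => (Fin.cons 2 c : Fin (k + 1) → Fin 3) ∈ T))))) = true) : ℕ)) : ℝ))
          (by push_cast [Nat.cast_sub ha0]; ring) (by push_cast [Nat.cast_sub ha1]; ring)
          (by positivity) (by positivity) (by positivity)
          (by push_cast [Nat.cast_sub ha0]; have := (Nat.cast_le (α := ℝ)).2 h0; push_cast at this; linarith)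
          (by push_cast [Nat.cast_sub ha1]; have := (Nat.cast_le (α := ℝ)).2 h1; push_cast at this; linarith)
          (by push_cast [Nat.cast_sub ha2]; have := (Nat.cast_le (α := ℝ)).2 h2; push_cast at this; linarith)
        have hr' : ((2 * ((2 ^ 3 ^ k - #((univ : Finset ((Fin k → Fin 3) → Bool)).filter fun s => (Literature.Computability.Complexity.recMaj (fun (_ : Unit → Bool) (ω : Unit → Bool) => ω ()) (k) (fun (_ : Unit) => false) (fun c (_ : Unit) => (s c || decide (c ∈ ((univ : Finset (Fin k → Fin 3)).filter fun c => (Fin.cons 0 c : Fin (k + 1) → Fin 3) ∈ T))))) = true)) * (2 ^ 3 ^ k - #((univ : Finset ((Fin k → Fin 3) → Bool)).filter fun s => (Literature.Computability.Complexity.recMaj (fun (_ : Unit → Bool) (ω : Unit → Bool) => ω ()) (k) (fun (_ : Unit) => false) (fun c (_ : Unit) => (s c || decide (c ∈ ((univ : Finset (Fin k → Fin 3)).filter fun c => (Fin.cons 1 c : Fin (k + 1) → Fin 3) ∈ T))))) = true)) * 2 ^ 3 ^ k +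
            (2 ^ 3 ^ k - #((univ : Finset ((Fin k → Fin 3) → Bool)).filter fun s => (Literature.Computability.Complexity.recMaj (fun (_ : Unit → Bool) (ω : Unit → Bool) => ω ()) (k) (fun (_ : Unit) => false) (fun c (_ : Unit) => (s c || decide (c ∈ ((univ : Finset (Fin k → Fin 3)).filter fun c => (Fin.cons 0 c : Fin (k + 1) → Fin 3) ∈ T))))) = true)) * #((univ : Finset ((Fin k → Fin 3) → Bool)).filter fun s => (Literature.Computability.Complexity.recMaj (fun (_ : Unit → Bool) (ω : Unit → Bool) => ω ()) (k) (fun (_ : Unit) => false) (fun c (_ : Unit) => (s c || decide (c ∈ ((univ : Finset (Fin k → Fin 3)).filter fun c => (Fin.cons 1 c : Fin (k + 1) → Fin 3) ∈ T))))) = true) * (2 ^ 3 ^ k - #((univ : Finset ((Fin k → Fin 3) → Bool)).filter fun s => (Literature.Computability.Complexity.recMaj (fun (_ : Unit → Bool) (ω : Unit → Bool) => ω ()) (k) (fun (_ : Unit) => false) (fun c (_ : Unit) => (s c || decide (c ∈ ((univ : Finset (Fin k → Fin 3)).filter fun c => (Fin.cons 2 c : Fin (k + 1) → Fin 3) ∈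 T))))) = true)) +
            #((univ : Finset ((Fin k → Fin 3) → Bool)).filter fun s => (Literature.Computability.Complexity.recMaj (fun (_ : Unit → Bool) (ω : Unit → Bool) => ω ()) (k) (fun (_ : Unit) => false) (fun c (_ : Unit) => (s c || decide (c ∈ ((univ : Finset (Fin k → Fin 3)).filter fun c => (Fin.cons 0 c : Fin (k + 1) → Fin 3) ∈ T))))) = true) * (2 ^ 3 ^ k - #((univ : Finset ((Fin k → Fin 3) → Bool)).filter fun s => (Literature.Computability.Complexity.recMaj (fun (_ : Unit → Bool) (ω : Unit → Bool) => ω ()) (k) (fun (_ : Unit) => false) (fun c (_ : Unit) => (s c || decide (c ∈ ((univ : Finset (Fin k → Fin 3)).filter fun c => (Fin.cons 1 c : Fin (k + 1) → Fin 3) ∈ T))))) = true)) * (2 ^ 3 ^ k - #((univ : Finset ((Fin k → Fin 3) → Bool)).filter fun s => (Literature.Computability.Complexity.recMaj (fun (_ : Unit → Bool) (ω : Unit → Bool) => ω ()) (k) (fun (_ : Unit) => false) (fun c (_ : Unit) => (s c || decide (c ∈ ((univ : Finset (Fin k → Fin 3)).filter fun c => (Fin.cons 2 c : Fin (k + 1)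 → Fin 3) ∈ T))))) = true))) : ℕ) : ℝ) ≤ ((2 ^ 3 ^ k * 2 ^ 3 ^ k * 2 ^ 3 ^ k : ℕ) : ℝ) := by
          push_cast [Nat.cast_sub ha0, Nat.cast_sub ha1, Nat.cast_sub ha2] at hr ⊢
          linarith
        exact_mod_cast hr'
      rw [eAcc, pow_succ, pow_mul]
      have hM3 : (2 ^ 3 ^ k) ^ 3 = 2 ^ 3 ^ k * 2 ^ 3 ^ k * 2 ^ 3 ^ k := by ring
      rw [hM3] at htot ⊢
      generalize 2 ^ 3 ^ k = M at *
      nlinarith [hRej, htot, hrej]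
    · -- (b) the new leaf `e = i :: p` sits in subtree `i`
      intro e
      obtain ⟨i, p, rfl⟩ : ∃ i p, e = Fin.cons i p := ⟨e 0, Fin.tail e, (Fin.cons_self_tail e).symm⟩
      -- transfer to the subtree triples
      have eGain : #((univ : Finset ((Fin (k + 1) → Fin 3) → Bool)).filter fun y =>
          (Literature.Computability.Complexity.recMaj (fun (_ : Unit → Bool) (ω : Unit → Bool) => ω ()) (k + 1) (fun (_ : Unit) => false) (fun c (_ : Unit) => (y c || decide (c ∈ insert (Fin.cons i p) T)))) = true ∧ (Literature.Computability.Complexity.recMaj (fun (_ : Unit → Bool) (ω : Unit → Bool) => ω ()) (k + 1) (fun (_ : Unit) => false) (fun c (_ : Unit) => (y c || decide (c ∈ T)))) = false) =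
          #((univ : Finset (Fin 3 → ((Fin k → Fin 3) → Bool))).filter fun θ => maj3 (Literature.Computability.Complexity.recMaj (fun (_ : Unit → Bool) (ω : Unit → Bool) => ω ()) (k) (fun (_ : Unit) => false) (fun c (_ : Unit) => ((θ 0) c || decide (c ∈ ((univ : Finset (Fin k → Fin 3)).filter fun c => (Fin.cons 0 c : Fin (k + 1) → Fin 3) ∈ insert (Fin.cons i p) T))))) (Literature.Computability.Complexity.recMaj (fun (_ : Unit → Bool) (ω : Unit → Bool) => ω ()) (k) (fun (_ : Unit) => false) (fun c (_ : Unit) => ((θ 1) c || decide (c ∈ ((univ : Finset (Fin k → Fin 3)).filter fun c => (Fin.cons 1 c : Fin (k + 1) → Fin 3) ∈ insert (Fin.cons i p) T))))) (Literature.Computability.Complexity.recMaj (fun (_ : Unit → Bool) (ω : Unit → Bool) => ω ()) (k) (fun (_ : Unit) => false) (fun c (_ : Unit) => ((θ 2) c || decide (c ∈ ((univ : Finset (Fin k → Fin 3)).filter fun c => (Fin.cons 2 c : Fin (k + 1) → Fin 3) ∈ insert (Fin.cons i p) T))))) = true ∧ maj3 (Literature.Computability.Complexity.recMaj (fun (_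 : Unit → Bool) (ω : Unit → Bool) => ω ()) (k) (fun (_ : Unit) => false) (fun c (_ : Unit) => ((θ 0) c || decide (c ∈ ((univ : Finset (Fin k → Fin 3)).filter fun c => (Fin.cons 0 c : Fin (k + 1) → Fin 3) ∈ T))))) (Literature.Computability.Complexity.recMaj (fun (_ : Unit → Bool) (ω : Unit → Bool) => ω ()) (k) (fun (_ : Unit) => false) (fun c (_ : Unit) => ((θ 1) c || decide (c ∈ ((univ : Finset (Fin k → Fin 3)).filter fun c => (Fin.cons 1 c : Fin (k + 1) → Fin 3) ∈ T))))) (Literature.Computability.Complexity.recMaj (fun (_ : Unit → Bool) (ω : Unit → Bool) => ω ()) (k) (fun (_ : Unit) => false) (fun c (_ : Unit) => ((θ 2) c || decide (c ∈ ((univ : Finset (Fin k → Fin 3)).filter fun c => (Fin.cons 2 c : Fin (k + 1) → Fin 3) ∈ T))))) = false) := by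
        rw [← card_filter_succ_eq k (fun θ => maj3 (Literature.Computability.Complexity.recMaj (fun (_ : Unit → Bool) (ω : Unit → Bool) => ω ()) (k) (fun (_ : Unit) => false) (fun c (_ : Unit) => ((θ 0) c || decide (c ∈ ((univ : Finset (Fin k → Fin 3)).filter fun c => (Fin.cons 0 c : Fin (k + 1) → Fin 3) ∈ insert (Fin.cons i p) T))))) (Literature.Computability.Complexity.recMaj (fun (_ : Unit → Bool) (ω : Unit → Bool) => ω ()) (k) (fun (_ : Unit) => false) (fun c (_ : Unit) => ((θ 1) c || decide (c ∈ ((univ : Finset (Fin k → Fin 3)).filter fun c => (Fin.cons 1 c : Fin (k + 1) → Fin 3) ∈ insert (Fin.cons i p) T))))) (Literature.Computability.Complexity.recMaj (fun (_ : Unit → Bool) (ω : Unit → Bool) => ω ()) (k) (fun (_ : Unit) => false) (fun c (_ : Unit) => ((θ 2) c || decide (c ∈ ((univ : Finset (Fin k → Fin 3)).filter fun c => (Fin.cons 2 c : Fin (k + 1) → Fin 3) ∈ insert (Fin.cons i p) T))))) = true ∧ maj3 (Literature.Computability.Complexity.recMaj (fun (_ : Unit → Bool) (ω : Unit → Bool)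 => ω ()) (k) (fun (_ : Unit) => false) (fun c (_ : Unit) => ((θ 0) c || decide (c ∈ ((univ : Finset (Fin k → Fin 3)).filter fun c => (Fin.cons 0 c : Fin (k + 1) → Fin 3) ∈ T))))) (Literature.Computability.Complexity.recMaj (fun (_ : Unit → Bool) (ω : Unit → Bool) => ω ()) (k) (fun (_ : Unit) => false) (fun c (_ : Unit) => ((θ 1) c || decide (c ∈ ((univ : Finset (Fin k → Fin 3)).filter fun c => (Fin.cons 1 c : Fin (k + 1) → Fin 3) ∈ T))))) (Literature.Computability.Complexity.recMaj (fun (_ : Unit → Bool) (ω : Unit → Bool) => ω ()) (k) (fun (_ : Unit) => false) (fun c (_ : Unit) => ((θ 2) c || decide (c ∈ ((univ : Finset (Fin k → Fin 3)).filter fun c => (Fin.cons 2 c : Fin (k + 1) → Fin 3) ∈ T))))) = false)]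
        exact congrArg Finset.card (filter_congr fun y _ => by rw [recMaj_succ_upShift, recMaj_succ_upShift])
      -- the gain triples: subtree `i` gained and the two others disagree
      have hsub : ((univ : Finset (Fin 3 → ((Fin k → Fin 3) → Bool))).filter fun θ => maj3 (Literature.Computability.Complexity.recMaj (fun (_ : Unit → Bool) (ω : Unit → Bool) => ω ()) (k) (fun (_ : Unit) => false) (fun c (_ : Unit) => ((θ 0) c || decide (c ∈ ((univ : Finset (Fin k → Fin 3)).filter fun c => (Fin.cons 0 c : Fin (k + 1) → Fin 3) ∈ insert (Fin.cons i p) T))))) (Literature.Computability.Complexity.recMaj (fun (_ : Unit → Bool) (ω : Unit → Bool) => ω ()) (k) (fun (_ : Unit) => false) (fun c (_ : Unit) => ((θ 1) c || decide (c ∈ ((univ : Finset (Fin k → Fin 3)).filter fun c => (Fin.cons 1 c : Fin (k + 1) → Fin 3) ∈ insert (Fin.cons i p) T))))) (Literature.Computability.Complexity.recMaj (fun (_ : Unit → Bool) (ω : Unit → Bool) => ω ()) (k) (fun (_ : Unit) => false) (fun c (_ : Unit) => ((θ 2) c || decide (c ∈ ((univ : Finset (Fin k → Fin 3)).filter fun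 c => (Fin.cons 2 c : Fin (k + 1) → Fin 3) ∈ insert (Fin.cons i p) T))))) = true ∧ maj3 (Literature.Computability.Complexity.recMaj (fun (_ : Unit → Bool) (ω : Unit → Bool) => ω ()) (k) (fun (_ : Unit) => false) (fun c (_ : Unit) => ((θ 0) c || decide (c ∈ ((univ : Finset (Fin k → Fin 3)).filter fun c => (Fin.cons 0 c : Fin (k + 1) → Fin 3) ∈ T))))) (Literature.Computability.Complexity.recMaj (fun (_ : Unit → Bool) (ω : Unit → Bool) => ω ()) (k) (fun (_ : Unit) => false) (fun c (_ : Unit) => ((θ 1) c || decide (c ∈ ((univ : Finset (Fin k → Fin 3)).filter fun c => (Fin.cons 1 c : Fin (k + 1) → Fin 3) ∈ T))))) (Literature.Computability.Complexity.recMaj (fun (_ : Unit → Bool) (ω : Unit → Bool) => ω ()) (k) (fun (_ : Unit) => false) (fun c (_ : Unit) => ((θ 2) c || decide (c ∈ ((univ : Finset (Fin k → Fin 3)).filter fun c => (Fin.cons 2 c : Fin (k + 1) → Fin 3) ∈ T))))) = false) ⊆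
          (univ : Finset (Fin 3 → ((Fin k → Fin 3) → Bool))).filter fun θ => θ i ∈ ((univ : Finset ((Fin k → Fin 3) → Bool)).filter fun s => (Literature.Computability.Complexity.recMaj (fun (_ : Unit → Bool) (ω : Unit → Bool) => ω ()) (k) (fun (_ : Unit) => false) (fun c (_ : Unit) => (s c || decide (c ∈ insert p ((univ : Finset (Fin k → Fin 3)).filter fun c => (Fin.cons i c : Fin (k + 1) → Fin 3) ∈ T))))) = true ∧ (Literature.Computability.Complexity.recMaj (fun (_ : Unit → Bool) (ω : Unit → Bool) => ω ()) (k) (fun (_ : Unit) => false) (fun c (_ : Unit) => (s c || decide (c ∈ ((univ : Finset (Fin k → Fin 3)).filter fun c => (Fin.cons i c : Fin (k + 1) → Fin 3) ∈ T))))) = false) ∧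
            (θ (i.succAbove 0) ∈ ((univ : Finset ((Fin k → Fin 3) → Bool)).filter fun s => (Literature.Computability.Complexity.recMaj (fun (_ : Unit → Bool) (ω : Unit → Bool) => ω ()) (k) (fun (_ : Unit) => false) (fun c (_ : Unit) => (s c || decide (c ∈ ((univ : Finset (Fin k → Fin 3)).filter fun c => (Fin.cons (i.succAbove 0) c : Fin (k + 1) → Fin 3) ∈ T))))) = true)) ≠ (θ (i.succAbove 1) ∈ ((univ : Finset ((Fin k → Fin 3) → Bool)).filter fun s => (Literature.Computability.Complexity.recMaj (fun (_ : Unit → Bool) (ω : Unit → Bool) => ω ()) (k) (fun (_ : Unit) => false) (fun c (_ : Unit) => (s c || decide (c ∈ ((univ : Finset (Fin k → Fin 3)).filter fun c => (Fin.cons (i.succAbove 1) c : Fin (k + 1) → Fin 3) ∈ T))))) = true)) := by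
        intro θ hθ
        rw [mem_filter] at hθ ⊢
        refine ⟨mem_univ _, ?_⟩
        -- the triple of restricted subtree values, and the gained value of subtree `i`
        have key := maj3_gain_general i (fun j => (Literature.Computability.Complexity.recMaj (fun (_ : Unit → Bool) (ω : Unit → Bool) => ω ()) (k) (fun (_ : Unit) => false) (fun c (_ : Unit) => ((θ j) c || decide (c ∈ ((univ : Finset (Fin k → Fin 3)).filter fun c => (Fin.cons j c : Fin (k + 1) → Fin 3) ∈ T)))))) (Literature.Computability.Complexity.recMaj (fun (_ : Unit → Bool) (ω : Unit → Bool) => ω ()) (k) (fun (_ : Unit) => false) (fun c (_ : Unit) => ((θ i) c || decide (c ∈ insert p ((univ : Finset (Fin k → Fin 3)).filter fun c => (Fin.cons i c : Fin (k + 1) → Fin 3) ∈ T)))))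
          (fun h => by
            have hle : (Literature.Computability.Complexity.recMaj (fun (_ : Unit → Bool) (ω : Unit → Bool) => ω ()) (k) (fun (_ : Unit) => false) (fun c (_ : Unit) => ((θ i) c || decide (c ∈ ((univ : Finset (Fin k → Fin 3)).filter fun c => (Fin.cons i c : Fin (k + 1) → Fin 3) ∈ T))))) ≤ (Literature.Computability.Complexity.recMaj (fun (_ : Unit → Bool) (ω : Unit → Bool) => ω ()) (k) (fun (_ : Unit) => false) (fun c (_ : Unit) => ((θ i) c || decide (c ∈ insert p ((univ : Finset (Fin k → Fin 3)).filter fun c => (Fin.cons i c : Fin (k + 1) → Fin 3) ∈ T))))) :=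
              recMaj_mono k (upShift_le_upShift_insert (θ i) ((univ : Finset (Fin k → Fin 3)).filter fun c => (Fin.cons i c : Fin (k + 1) → Fin 3) ∈ T) p)
            rw [h] at hle
            exact Bool.eq_true_of_true_le hle)
          (by
            have hupd : ∀ j : Fin 3, (Literature.Computability.Complexity.recMaj (fun (_ : Unit → Bool) (ω : Unit → Bool) => ω ()) (k) (fun (_ : Unit) => false) (fun c (_ : Unit) => ((θ j) c || decide (c ∈ ((univ : Finset (Fin k → Fin 3)).filter fun c => (Fin.cons j c : Fin (k + 1) → Fin 3) ∈ insert (Fin.cons i p) T))))) =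
                Function.update (fun j => (Literature.Computability.Complexity.recMaj (fun (_ : Unit → Bool) (ω : Unit → Bool) => ω ()) (k) (fun (_ : Unit) => false) (fun c (_ : Unit) => ((θ j) c || decide (c ∈ ((univ : Finset (Fin k → Fin 3)).filter fun c => (Fin.cons j c : Fin (k + 1) → Fin 3) ∈ T)))))) i (Literature.Computability.Complexity.recMaj (fun (_ : Unit → Bool) (ω : Unit → Bool) => ω ()) (k) (fun (_ : Unit) => false) (fun c (_ : Unit) => ((θ i) c || decide (c ∈ insert p ((univ : Finset (Fin k → Fin 3)).filter fun c => (Fin.cons i c : Fin (k + 1) → Fin 3) ∈ T))))) j := by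
              intro j
              by_cases hji : j = i
              · subst hji
                rw [Function.update_self, filter_cons_insert_self]
              · rw [Function.update_of_ne hji, filter_cons_insert_ne k T hji]
            rw [← hupd 0, ← hupd 1, ← hupd 2]
            exact hθ.2.1)
          hθ.2.2
        obtain ⟨⟨hn1, hvi⟩, hdis⟩ := key
        refine ⟨mem_filter.2 ⟨mem_univ _, hn1, hvi⟩, ?_⟩
        rw [ne_eq]
        intro hEq
        apply hdis
        rw [Bool.eq_iff_iff]
        constructor
        · intro h
          exact (mem_filter.1 (Eq.mp hEq (mem_filter.2 ⟨mem_univ _, h⟩ : θ (i.succAbove 0) ∈ ((univ : Finset ((Fin k → Fin 3) → Bool)).filter fun s => (Literature.Computability.Complexity.recMaj (fun (_ : Unit → Bool) (ω : Unit → Bool) => ω ()) (k) (fun (_ : Unit) => false) (fun c (_ : Unit) => (s c || decide (c ∈ ((univ : Finset (Fin k → Fin 3)).filter fun c => (Fin.cons (i.succAbove 0) c : Fin (k + 1) → Fin 3) ∈ T))))) = true)))).2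
        · intro h
          exact (mem_filter.1 (Eq.mpr hEq (mem_filter.2 ⟨mem_univ _, h⟩ : θ (i.succAbove 1) ∈ ((univ : Finset ((Fin k → Fin 3) → Bool)).filter fun s => (Literature.Computability.Complexity.recMaj (fun (_ : Unit → Bool) (ω : Unit → Bool) => ω ()) (k) (fun (_ : Unit) => false) (fun c (_ : Unit) => (s c || decide (c ∈ ((univ : Finset (Fin k → Fin 3)).filter fun c => (Fin.cons (i.succAbove 1) c : Fin (k + 1) → Fin 3) ∈ T))))) = true)))).2
      -- count the box: coordinate `i` times the disagreeing pairs
      have hcardΦ : #((univ : Finset (Fin 3 → ((Fin k → Fin 3) → Bool))).filter fun θ => θ i ∈ ((univ : Finset ((Fin k → Fin 3) → Bool)).filter fun s => (Literature.Computability.Complexity.recMaj (fun (_ : Unit → Bool) (ω : Unit → Bool) => ω ()) (k) (fun (_ : Unit) => false) (fun c (_ : Unit) => (s c || decide (c ∈ insert p ((univ : Finset (Fin k → Fin 3)).filter fun c => (Fin.cons i c : Fin (k + 1) → Fin 3) ∈ T))))) = true ∧ (Literature.Computability.Complexity.recMaj (fun (_ : Unit → Bool) (ω : Unit → Bool) =>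 ω ()) (k) (fun (_ : Unit) => false) (fun c (_ : Unit) => (s c || decide (c ∈ ((univ : Finset (Fin k → Fin 3)).filter fun c => (Fin.cons i c : Fin (k + 1) → Fin 3) ∈ T))))) = false) ∧
            (θ (i.succAbove 0) ∈ ((univ : Finset ((Fin k → Fin 3) → Bool)).filter fun s => (Literature.Computability.Complexity.recMaj (fun (_ : Unit → Bool) (ω : Unit → Bool) => ω ()) (k) (fun (_ : Unit) => false) (fun c (_ : Unit) => (s c || decide (c ∈ ((univ : Finset (Fin k → Fin 3)).filter fun c => (Fin.cons (i.succAbove 0) c : Fin (k + 1) → Fin 3) ∈ T))))) = true)) ≠ (θ (i.succAbove 1) ∈ ((univ : Finset ((Fin k → Fin 3) → Bool)).filter fun s => (Literature.Computability.Complexity.recMaj (fun (_ : Unit → Bool) (ω : Unit → Bool) => ω ()) (k) (fun (_ : Unit) => false) (fun c (_ : Unit) => (s c || decide (c ∈ ((univ : Finset (Fin k → Fin 3)).filter fun c => (Fin.cons (i.succAbove 1) c : Fin (k + 1) → Fin 3) ∈ T))))) = true))) =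
          #((univ : Finset ((Fin k → Fin 3) → Bool)).filter fun s => (Literature.Computability.Complexity.recMaj (fun (_ : Unit → Bool) (ω : Unit → Bool) => ω ()) (k) (fun (_ : Unit) => false) (fun c (_ : Unit) => (s c || decide (c ∈ insert p ((univ : Finset (Fin k → Fin 3)).filter fun c => (Fin.cons i c : Fin (k + 1) → Fin 3) ∈ T))))) = true ∧ (Literature.Computability.Complexity.recMaj (fun (_ : Unit → Bool) (ω : Unit → Bool) => ω ()) (k) (fun (_ : Unit) => false) (fun c (_ : Unit) => (s c || decide (c ∈ ((univ : Finset (Fin k → Fin 3)).filter fun c => (Fin.cons i c : Fin (k + 1) → Fin 3) ∈ T))))) = false) * (#((univ : Finset ((Fin k → Fin 3) → Bool)).filter fun s => (Literature.Computability.Complexity.recMaj (fun (_ : Unit → Bool) (ω : Unit → Bool) => ω ()) (k) (fun (_ : Unit) => false) (fun c (_ : Unit) => (s c || decide (c ∈ ((univ : Finset (Fin k → Fin 3)).filter fun c => (Fin.cons (i.succAbove 0) c : Fin (k + 1) → Fin 3) ∈ T))))) = true) * (2 ^ 3 ^ k - #((univ : Finset ((Fin k → Fin 3) → Bool)).filter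 fun s => (Literature.Computability.Complexity.recMaj (fun (_ : Unit → Bool) (ω : Unit → Bool) => ω ()) (k) (fun (_ : Unit) => false) (fun c (_ : Unit) => (s c || decide (c ∈ ((univ : Finset (Fin k → Fin 3)).filter fun c => (Fin.cons (i.succAbove 1) c : Fin (k + 1) → Fin 3) ∈ T))))) = true)) + (2 ^ 3 ^ k - #((univ : Finset ((Fin k → Fin 3) → Bool)).filter fun s => (Literature.Computability.Complexity.recMaj (fun (_ : Unit → Bool) (ω : Unit → Bool) => ω ()) (k) (fun (_ : Unit) => false) (fun c (_ : Unit) => (s c || decide (c ∈ ((univ : Finset (Fin k → Fin 3)).filter fun c => (Fin.cons (i.succAbove 0) c : Fin (k + 1) → Fin 3) ∈ T))))) = true)) * #((univ : Finset ((Fin k → Fin 3) → Bool)).filter fun s => (Literature.Computability.Complexity.recMaj (fun (_ : Unit → Bool) (ω : Unit → Bool) => ω ()) (k) (fun (_ : Unit) => false) (fun c (_ : Unit) => (s c || decide (c ∈ ((univ : Finset (Fin k → Fin 3)).filter fun c => (Fin.cons (i.succAbove 1) c : Fin (k + 1) → Fin 3) ∈ T))))) = true)) := by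
        rw [← hcardS, ← card_disagree, ← card_product]
        refine card_equiv (Fin.insertNthEquiv (fun _ => ((Fin k → Fin 3) → Bool)) i).symm fun θ => ?_
        simp only [mem_filter, mem_univ, true_and, mem_product]
        exact Iff.rfl
      have hgain := card_le_card hsub
      rw [hcardΦ] at hgain
      -- the inductive bounds
      have hG := (ih ((univ : Finset (Fin k → Fin 3)).filter fun c => (Fin.cons i c : Fin (k + 1) → Fin 3) ∈ T)).2 p
      have hx := (ih ((univ : Finset (Fin k → Fin 3)).filter fun c => (Fin.cons (i.succAbove 0) c : Fin (k + 1) → Fin 3) ∈ T)).1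
      have hy := (ih ((univ : Finset (Fin k → Fin 3)).filter fun c => (Fin.cons (i.succAbove 1) c : Fin (k + 1) → Fin 3) ∈ T)).1
      have hxM : #((univ : Finset ((Fin k → Fin 3) → Bool)).filter fun s => (Literature.Computability.Complexity.recMaj (fun (_ : Unit → Bool) (ω : Unit → Bool) => ω ()) (k) (fun (_ : Unit) => false) (fun c (_ : Unit) => (s c || decide (c ∈ ((univ : Finset (Fin k → Fin 3)).filter fun c => (Fin.cons (i.succAbove 0) c : Fin (k + 1) → Fin 3) ∈ T))))) = true) ≤ 2 ^ 3 ^ k := by rw [← hcardS]; exact card_le_univ _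
      have hyM : #((univ : Finset ((Fin k → Fin 3) → Bool)).filter fun s => (Literature.Computability.Complexity.recMaj (fun (_ : Unit → Bool) (ω : Unit → Bool) => ω ()) (k) (fun (_ : Unit) => false) (fun c (_ : Unit) => (s c || decide (c ∈ ((univ : Finset (Fin k → Fin 3)).filter fun c => (Fin.cons (i.succAbove 1) c : Fin (k + 1) → Fin 3) ∈ T))))) = true) ≤ 2 ^ 3 ^ k := by rw [← hcardS]; exact card_le_univ _
      have hcross : 2 * (#((univ : Finset ((Fin k → Fin 3) → Bool)).filter fun s => (Literature.Computability.Complexity.recMaj (fun (_ : Unit → Bool) (ω : Unit → Bool) => ω ()) (k) (fun (_ : Unit) => false) (fun c (_ : Unit) => (s c || decide (c ∈ ((univ : Finset (Fin k → Fin 3)).filter fun c => (Fin.cons (i.succAbove 0) c : Fin (k + 1) → Fin 3) ∈ T))))) = true) * (2 ^ 3 ^ k - #((univ : Finset ((Fin k → Fin 3) → Bool)).filter fun s => (Literature.Computability.Complexity.recMaj (fun (_ : Unit → Bool) (ω : Unit → Bool) => ω ()) (k) (fun (_ : Unit) => false) (fun c (_ : Unit) => (s c || decide (c ∈ ((univ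 : Finset (Fin k → Fin 3)).filter fun c => (Fin.cons (i.succAbove 1) c : Fin (k + 1) → Fin 3) ∈ T))))) = true)) + (2 ^ 3 ^ k - #((univ : Finset ((Fin k → Fin 3) → Bool)).filter fun s => (Literature.Computability.Complexity.recMaj (fun (_ : Unit → Bool) (ω : Unit → Bool) => ω ()) (k) (fun (_ : Unit) => false) (fun c (_ : Unit) => (s c || decide (c ∈ ((univ : Finset (Fin k → Fin 3)).filter fun c => (Fin.cons (i.succAbove 0) c : Fin (k + 1) → Fin 3) ∈ T))))) = true)) * #((univ : Finset ((Fin k → Fin 3) → Bool)).filter fun s => (Literature.Computability.Complexity.recMaj (fun (_ : Unit → Bool) (ω : Unit → Bool) => ω ()) (k) (fun (_ : Unit) => false) (fun c (_ : Unit) => (s c || decide (c ∈ ((univ : Finset (Fin k → Fin 3)).filter fun c => (Fin.cons (i.succAbove 1) c : Fin (k + 1) → Fin 3) ∈ T))))) = true)) ≤ 2 ^ 3 ^ k * 2 ^ 3 ^ k := by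
        have hc := two_mul_cross_le (M := ((2 ^ 3 ^ k : ℕ) : ℝ)) (a := (#((univ : Finset ((Fin k → Fin 3) → Bool)).filter fun s => (Literature.Computability.Complexity.recMaj (fun (_ : Unit → Bool) (ω : Unit → Bool) => ω ()) (k) (fun (_ : Unit) => false) (fun c (_ : Unit) => (s c || decide (c ∈ ((univ : Finset (Fin k → Fin 3)).filter fun c => (Fin.cons (i.succAbove 0) c : Fin (k + 1) → Fin 3) ∈ T))))) = true) : ℝ)) (b := (((2 ^ 3 ^ k - #((univ : Finset ((Fin k → Fin 3) → Bool)).filter fun s => (Literature.Computability.Complexity.recMaj (fun (_ : Unit → Bool) (ω : Unit → Bool) => ω ()) (k) (fun (_ : Unit) => false) (fun c (_ : Unit) => (s c || decide (c ∈ ((univ : Finset (Fin k → Fin 3)).filter fun c => (Fin.cons (i.succAbove 0) c : Fin (k + 1) → Fin 3) ∈ T))))) = true) : ℕ)) : ℝ))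
          (a' := (#((univ : Finset ((Fin k → Fin 3) → Bool)).filter fun s => (Literature.Computability.Complexity.recMaj (fun (_ : Unit → Bool) (ω : Unit → Bool) => ω ()) (k) (fun (_ : Unit) => false) (fun c (_ : Unit) => (s c || decide (c ∈ ((univ : Finset (Fin k → Fin 3)).filter fun c => (Fin.cons (i.succAbove 1) c : Fin (k + 1) → Fin 3) ∈ T))))) = true) : ℝ)) (b' := (((2 ^ 3 ^ k - #((univ : Finset ((Fin k → Fin 3) → Bool)).filter fun s => (Literature.Computability.Complexity.recMaj (fun (_ : Unit → Bool) (ω : Unit → Bool) => ω ()) (k) (fun (_ : Unit) => false) (fun c (_ : Unit) => (s c || decide (c ∈ ((univ : Finset (Fin k → Fin 3)).filter fun c => (Fin.cons (i.succAbove 1) c : Fin (k + 1) → Fin 3) ∈ T))))) = true) : ℕ)) : ℝ))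
          (by push_cast [Nat.cast_sub hxM]; ring) (by push_cast [Nat.cast_sub hyM]; ring)
          (by push_cast [Nat.cast_sub hxM]; have := (Nat.cast_le (α := ℝ)).2 hx; push_cast at this; linarith)
          (by push_cast [Nat.cast_sub hyM]; have := (Nat.cast_le (α := ℝ)).2 hy; push_cast at this; linarith)
        have hc' : ((2 * (#((univ : Finset ((Fin k → Fin 3) → Bool)).filter fun s => (Literature.Computability.Complexity.recMaj (fun (_ : Unit → Bool) (ω : Unit → Bool) => ω ()) (k) (fun (_ : Unit) => false) (fun c (_ : Unit) => (s c || decide (c ∈ ((univ : Finset (Fin k → Fin 3)).filter fun c => (Fin.cons (i.succAbove 0) c : Fin (k + 1) → Fin 3) ∈ T))))) = true) * (2 ^ 3 ^ k - #((univ : Finset ((Fin k → Fin 3) → Bool)).filter fun s => (Literature.Computability.Complexity.recMaj (fun (_ : Unit → Bool) (ω : Unit → Bool) => ω ()) (k) (fun (_ : Unit) => false) (fun c (_ : Unit) => (s c || decide (c ∈ ((univ : Finset (Fin k → Fin 3)).filter fun c => (Fin.cons (i.succAbove 1) c : Fin (k + 1) → Fin 3) ∈ T))))) = true)) + (2 ^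 3 ^ k - #((univ : Finset ((Fin k → Fin 3) → Bool)).filter fun s => (Literature.Computability.Complexity.recMaj (fun (_ : Unit → Bool) (ω : Unit → Bool) => ω ()) (k) (fun (_ : Unit) => false) (fun c (_ : Unit) => (s c || decide (c ∈ ((univ : Finset (Fin k → Fin 3)).filter fun c => (Fin.cons (i.succAbove 0) c : Fin (k + 1) → Fin 3) ∈ T))))) = true)) * #((univ : Finset ((Fin k → Fin 3) → Bool)).filter fun s => (Literature.Computability.Complexity.recMaj (fun (_ : Unit → Bool) (ω : Unit → Bool) => ω ()) (k) (fun (_ : Unit) => false) (fun c (_ : Unit) => (s c || decide (c ∈ ((univ : Finset (Fin k → Fin 3)).filter fun c => (Fin.cons (i.succAbove 1) c : Fin (k + 1) → Fin 3) ∈ T))))) = true)) : ℕ) : ℝ) ≤ ((2 ^ 3 ^ k * 2 ^ 3 ^ k : ℕ) : ℝ) := by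
          push_cast [Nat.cast_sub hxM, Nat.cast_sub hyM] at hc ⊢
          linarith
        exact_mod_cast hc'
      rw [eGain]
      calc #((univ : Finset (Fin 3 → ((Fin k → Fin 3) → Bool))).filter fun θ => maj3 (Literature.Computability.Complexity.recMaj (fun (_ : Unit → Bool) (ω : Unit → Bool) => ω ()) (k) (fun (_ : Unit) => false) (fun c (_ : Unit) => ((θ 0) c || decide (c ∈ ((univ : Finset (Fin k → Fin 3)).filter fun c => (Fin.cons 0 c : Fin (k + 1) → Fin 3) ∈ insert (Fin.cons i p) T))))) (Literature.Computability.Complexity.recMaj (fun (_ : Unit → Bool) (ω : Unit → Bool) => ω ()) (k) (fun (_ : Unit) => false) (fun c (_ : Unit) => ((θ 1) c || decide (c ∈ ((univ : Finset (Fin k → Fin 3)).filter fun c => (Fin.cons 1 c : Fin (k + 1) → Fin 3) ∈ insert (Fin.cons i p) T))))) (Literature.Computability.Complexity.recMaj (fun (_ : Unit → Bool) (ω : Unit → Bool) => ω ()) (k) (fun (_ : Unit) => false) (fun c (_ : Unit) => ((θ 2) c || decide (c ∈ ((univ : Finset (Fin k → Fin 3)).filter fun c => (Fin.cons 2 c :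 Fin (k + 1) → Fin 3) ∈ insert (Fin.cons i p) T))))) = true ∧ maj3 (Literature.Computability.Complexity.recMaj (fun (_ : Unit → Bool) (ω : Unit → Bool) => ω ()) (k) (fun (_ : Unit) => false) (fun c (_ : Unit) => ((θ 0) c || decide (c ∈ ((univ : Finset (Fin k → Fin 3)).filter fun c => (Fin.cons 0 c : Fin (k + 1) → Fin 3) ∈ T))))) (Literature.Computability.Complexity.recMaj (fun (_ : Unit → Bool) (ω : Unit → Bool) => ω ()) (k) (fun (_ : Unit) => false) (fun c (_ : Unit) => ((θ 1) c || decide (c ∈ ((univ : Finset (Fin k → Fin 3)).filter fun c => (Fin.cons 1 c : Fin (k + 1) → Fin 3) ∈ T))))) (Literature.Computability.Complexity.recMaj (fun (_ : Unit → Bool) (ω : Unit → Bool) => ω ()) (k) (fun (_ : Unit) => false) (fun c (_ : Unit) => ((θ 2) c || decide (c ∈ ((univ : Finset (Fin k → Fin 3)).filter fun c => (Fin.cons 2 c : Fin (k + 1) → Fin 3) ∈ T))))) = false) * 2 ^ (k + 1 + 1)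
          ≤ #((univ : Finset ((Fin k → Fin 3) → Bool)).filter fun s => (Literature.Computability.Complexity.recMaj (fun (_ : Unit → Bool) (ω : Unit → Bool) => ω ()) (k) (fun (_ : Unit) => false) (fun c (_ : Unit) => (s c || decide (c ∈ insert p ((univ : Finset (Fin k → Fin 3)).filter fun c => (Fin.cons i c : Fin (k + 1) → Fin 3) ∈ T))))) = true ∧ (Literature.Computability.Complexity.recMaj (fun (_ : Unit → Bool) (ω : Unit → Bool) => ω ()) (k) (fun (_ : Unit) => false) (fun c (_ : Unit) => (s c || decide (c ∈ ((univ : Finset (Fin k → Fin 3)).filter fun c => (Fin.cons i c : Fin (k + 1) → Fin 3) ∈ T))))) = false) * (#((univ : Finset ((Fin k → Fin 3) → Bool)).filter fun s => (Literature.Computability.Complexity.recMaj (fun (_ : Unit → Bool) (ω : Unit → Bool) => ω ()) (k) (fun (_ : Unit) => false) (fun c (_ : Unit) => (s c || decide (c ∈ ((univ : Finset (Fin k → Fin 3)).filter fun c => (Fin.cons (i.succAbove 0) c : Fin (k + 1) → Fin 3) ∈ T))))) = true) * (2 ^ 3 ^ k - #((univ : Finset ((Fin k → Fin 3) → Bool)).filter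 fun s => (Literature.Computability.Complexity.recMaj (fun (_ : Unit → Bool) (ω : Unit → Bool) => ω ()) (k) (fun (_ : Unit) => false) (fun c (_ : Unit) => (s c || decide (c ∈ ((univ : Finset (Fin k → Fin 3)).filter fun c => (Fin.cons (i.succAbove 1) c : Fin (k + 1) → Fin 3) ∈ T))))) = true)) + (2 ^ 3 ^ k - #((univ : Finset ((Fin k → Fin 3) → Bool)).filter fun s => (Literature.Computability.Complexity.recMaj (fun (_ : Unit → Bool) (ω : Unit → Bool) => ω ()) (k) (fun (_ : Unit) => false) (fun c (_ : Unit) => (s c || decide (c ∈ ((univ : Finset (Fin k → Fin 3)).filter fun c => (Fin.cons (i.succAbove 0) c : Fin (k + 1) → Fin 3) ∈ T))))) = true)) * #((univ : Finset ((Fin k → Fin 3) → Bool)).filter fun s => (Literature.Computability.Complexity.recMaj (fun (_ : Unit → Bool) (ω : Unit → Bool) => ω ()) (k) (fun (_ : Unit) => false) (fun c (_ : Unit) => (s c || decide (c ∈ ((univ : Finset (Fin k → Fin 3)).filter fun c => (Fin.cons (i.succAbove 1) c : Fin (k + 1) → Fin 3) ∈ T))))) = true)) * 2 ^ (k + 1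 + 1) :=
            Nat.mul_le_mul_right _ hgain
        _ = (#((univ : Finset ((Fin k → Fin 3) → Bool)).filter fun s => (Literature.Computability.Complexity.recMaj (fun (_ : Unit → Bool) (ω : Unit → Bool) => ω ()) (k) (fun (_ : Unit) => false) (fun c (_ : Unit) => (s c || decide (c ∈ insert p ((univ : Finset (Fin k → Fin 3)).filter fun c => (Fin.cons i c : Fin (k + 1) → Fin 3) ∈ T))))) = true ∧ (Literature.Computability.Complexity.recMaj (fun (_ : Unit → Bool) (ω : Unit → Bool) => ω ()) (k) (fun (_ : Unit) => false) (fun c (_ : Unit) => (s c || decide (c ∈ ((univ : Finset (Fin k → Fin 3)).filter fun c => (Fin.cons i c : Fin (k + 1) → Fin 3) ∈ T))))) = false) * 2 ^ (k + 1)) * (2 * (#((univ : Finset ((Fin k → Fin 3) → Bool)).filter fun s => (Literature.Computability.Complexity.recMaj (fun (_ : Unit → Bool) (ω : Unit → Bool) => ω ()) (k) (fun (_ : Unit) => false) (fun c (_ : Unit) => (s c || decide (c ∈ ((univ : Finset (Fin k → Fin 3)).filter fun c => (Fin.cons (i.succAbove 0) c : Fin (k + 1) → Fin 3) ∈ T)))))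 = true) * (2 ^ 3 ^ k - #((univ : Finset ((Fin k → Fin 3) → Bool)).filter fun s => (Literature.Computability.Complexity.recMaj (fun (_ : Unit → Bool) (ω : Unit → Bool) => ω ()) (k) (fun (_ : Unit) => false) (fun c (_ : Unit) => (s c || decide (c ∈ ((univ : Finset (Fin k → Fin 3)).filter fun c => (Fin.cons (i.succAbove 1) c : Fin (k + 1) → Fin 3) ∈ T))))) = true)) + (2 ^ 3 ^ k - #((univ : Finset ((Fin k → Fin 3) → Bool)).filter fun s => (Literature.Computability.Complexity.recMaj (fun (_ : Unit → Bool) (ω : Unit → Bool) => ω ()) (k) (fun (_ : Unit) => false) (fun c (_ : Unit) => (s c || decide (c ∈ ((univ : Finset (Fin k → Fin 3)).filter fun c => (Fin.cons (i.succAbove 0) c : Fin (k + 1) → Fin 3) ∈ T))))) = true)) * #((univ : Finset ((Fin k → Fin 3) → Bool)).filter fun s => (Literature.Computability.Complexity.recMaj (fun (_ : Unit → Bool) (ω : Unit → Bool) => ω ()) (k) (fun (_ : Unit) => false) (fun c (_ : Unit) => (s c || decide (c ∈ ((univ : Finset (Fin k → Fin 3)).filter fun c => (Fin.cons (i.succAbove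 1) c : Fin (k + 1) → Fin 3) ∈ T))))) = true))) := by ring
        _ ≤ 2 ^ 3 ^ k * (2 ^ 3 ^ k * 2 ^ 3 ^ k) := Nat.mul_le_mul hG hcross
        _ = 2 ^ 3 ^ (k + 1) := by rw [pow_succ, pow_mul]; ring

/-! ### Assembly: recursive majority resists every shift -/

/-- **recMaj_shiftResistant** (registered helper sub-goal of stmt-PneNP-18026, scope of the shift lever,
part 3). Let a law on up-shifts (weights `w i ≥ 0`, `∑ w i = 1`, shift sets `Rf i` of leaves) ENTER the
recursive-majority coin with probability `≥ 3/4`: `∑ w i · #{y : RM(y ∨ 1_{Rf i}) = 1} ≥ ¾ · 2^{3^h}`.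
Then it forces `≥ 2^h/2` leaves on average (hybrid bound `shift_hybrid` with the gain bound
`recMaj_upShift_ind`, against the exact coin `two_mul_card_recMaj_true`), and its collision number is
`≥ 2^{4^h/(4·3^h)}` (`shift_collision`) — super-polynomial in the number `3^h` of leaves. [folklore] -/
theorem recMaj_shiftResistant :
    ∀ (h : ℕ) {ι : Type*} (s : Finset ι) (w : ι → ℝ), (∀ i ∈ s, 0 ≤ w i) → ∑ i ∈ s, w i = 1 → ∀ Rf : ι → Finset (Fin h → Fin 3), (3 / 4 : ℝ) * 2 ^ 3 ^ h ≤ ∑ i ∈ s, w i * (#((Finset.univ : Finset ((Fin h → Fin 3) → Bool)).filter fun y => Literature.Computability.Complexity.recMaj (fun (_ : Unit → Bool) (ω : Unit → Bool) => ω ()) h (fun (_ : Unit) => false) (fun c (_ : Unit) => (y c || decide (c ∈ Rf i))) = true) : ℝ) → (2 : ℝ) ^ h / 2 ≤ ∑ i ∈ s, w i * (#(Rf i) : ℝ) ∧ (2 : ℝ) ^ ((4 : ℝ) ^ h / (4 * 3 ^ h)) ≤ ∑ i ∈ s, ∑ j ∈ s, w i * w j * (2 : ℝ) ^ #(Rf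 i ∩ Rf j) := by
  intro h ι s w hw0 hw1 Rf hentry
  classical
  -- the gain bound of the recursive majority, as the hypothesis of the hybrid lemma
  have hlt : h < 3 ^ h := Nat.lt_pow_self (by norm_num)
  have hdvd : 2 ^ (h + 1) ∣ 2 ^ 3 ^ h := pow_dvd_pow 2 (Nat.succ_le_of_lt hlt)
  set G : ℕ := 2 ^ 3 ^ h / 2 ^ (h + 1) with hGdef
  have hGmul : G * 2 ^ (h + 1) = 2 ^ 3 ^ h := Nat.div_mul_cancel hdvd
  have hG : ∀ (T : Finset (Fin h → Fin 3)) (e : Fin h → Fin 3), e ∉ T →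
      #((univ : Finset ((Fin h → Fin 3) → Bool)).filter fun x =>
        (fun y : (Fin h → Fin 3) → Bool => (Literature.Computability.Complexity.recMaj (fun (_ : Unit → Bool) (ω : Unit → Bool) => ω ()) (h) (fun (_ : Unit) => false) (fun c (_ : Unit) => y c))) (fun a => x a || decide (a ∈ insert e T)) = true ∧
        (fun y : (Fin h → Fin 3) → Bool => (Literature.Computability.Complexity.recMaj (fun (_ : Unit → Bool) (ω : Unit → Bool) => ω ()) (h) (fun (_ : Unit) => false) (fun c (_ : Unit) => y c))) (fun a => x a || decide (a ∈ T)) = false) ≤ G := by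
    intro T e _
    show #((univ : Finset ((Fin h → Fin 3) → Bool)).filter fun x =>
        (Literature.Computability.Complexity.recMaj (fun (_ : Unit → Bool) (ω : Unit → Bool) => ω ()) (h) (fun (_ : Unit) => false) (fun c (_ : Unit) => (x c || decide (c ∈ insert e T)))) = true ∧ (Literature.Computability.Complexity.recMaj (fun (_ : Unit → Bool) (ω : Unit → Bool) => ω ()) (h) (fun (_ : Unit) => false) (fun c (_ : Unit) => (x c || decide (c ∈ T)))) = false) ≤ G
    rw [hGdef, Nat.le_div_iff_mul_le (by positivity)]
    exact (recMaj_upShift_ind h T).2 e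
  have hmono : Monotone (fun y : (Fin h → Fin 3) → Bool => (Literature.Computability.Complexity.recMaj (fun (_ : Unit → Bool) (ω : Unit → Bool) => ω ()) (h) (fun (_ : Unit) => false) (fun c (_ : Unit) => y c))) := fun y y' hle => recMaj_mono h hle
  have hhyb := sum_card_upShift_le_of_gain s w hw0 Rf (fun y : (Fin h → Fin 3) → Bool => (Literature.Computability.Complexity.recMaj (fun (_ : Unit → Bool) (ω : Unit → Bool) => ω ()) (h) (fun (_ : Unit) => false) (fun c (_ : Unit) => y c))) hmono G hG
  have hhyb' : ∑ i ∈ s, w i * (#((univ : Finset ((Fin h → Fin 3) → Bool)).filter fun y =>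
      (Literature.Computability.Complexity.recMaj (fun (_ : Unit → Bool) (ω : Unit → Bool) => ω ()) (h) (fun (_ : Unit) => false) (fun c (_ : Unit) => (y c || decide (c ∈ Rf i)))) = true) : ℝ) ≤
      (∑ i ∈ s, w i) * #((univ : Finset ((Fin h → Fin 3) → Bool)).filter fun y => (Literature.Computability.Complexity.recMaj (fun (_ : Unit → Bool) (ω : Unit → Bool) => ω ()) (h) (fun (_ : Unit) => false) (fun c (_ : Unit) => y c)) = true) +
        (G : ℝ) * ∑ i ∈ s, w i * #(Rf i) := hhyb
  rw [hw1, one_mul] at hhyb'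
  -- the exact coin: `#{RM = 1} = 2^{3^h} / 2`
  have hhalf := two_mul_card_recMaj_true h
  have hhalfR : (#((univ : Finset ((Fin h → Fin 3) → Bool)).filter fun y => (Literature.Computability.Complexity.recMaj (fun (_ : Unit → Bool) (ω : Unit → Bool) => ω ()) (h) (fun (_ : Unit) => false) (fun c (_ : Unit) => y c)) = true) : ℝ) =
      2 ^ 3 ^ h / 2 := by
    have := congrArg (fun n : ℕ => (n : ℝ)) hhalf
    push_cast at this
    linarith
  have hGR : (G : ℝ) * 2 ^ (h + 1) = 2 ^ 3 ^ h := by exact_mod_cast hGmul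
  have hGpos : (0 : ℝ) < G := by
    have h2 : (0 : ℝ) < 2 ^ 3 ^ h := by positivity
    have : (0 : ℝ) < (G : ℝ) * 2 ^ (h + 1) := by rw [hGR]; exact h2
    exact pos_of_mul_pos_left this (by positivity)
  -- (1) the mean shift size
  have hm : (2 : ℝ) ^ h / 2 ≤ ∑ i ∈ s, w i * (#(Rf i) : ℝ) := by
    rw [hhalfR] at hhyb'
    -- `G · m ≥ 2^{3^h} / 4` and `G = 2^{3^h} / 2^{h+1}`
    have h1 : (2 : ℝ) ^ 3 ^ h / 4 ≤ (G : ℝ) * ∑ i ∈ s, w i * (#(Rf i) : ℝ) := by linarith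
    have h2 : (G : ℝ) * ((2 : ℝ) ^ h / 2) = (2 : ℝ) ^ 3 ^ h / 4 := by
      rw [pow_succ] at hGR
      linarith [hGR]
    rw [← h2] at h1
    exact le_of_mul_le_mul_left h1 hGpos
  refine ⟨hm, ?_⟩
  -- (2) the collision number, against all `3^h` leaves
  have hcoll := exp_le_collision s w hw0 hw1 Rf (univ : Finset (Fin h → Fin 3))
  simp only [inter_univ, card_univ, Fintype.card_fun, Fintype.card_fin] at hcoll
  rw [Real.rpow_def_of_pos two_pos]
  refine le_trans ?_ hcoll
  rw [Real.exp_le_exp]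
  refine mul_le_mul_of_nonneg_left ?_ (Real.log_pos one_lt_two).le
  have h3 : (0 : ℝ) < 3 ^ h := by positivity
  push_cast
  rw [div_le_div_iff₀ (by positivity) h3]
  have hsq : ((2 : ℝ) ^ h / 2) ^ 2 ≤ (∑ i ∈ s, w i * (#(Rf i) : ℝ)) ^ 2 :=
    pow_le_pow_left₀ (by positivity) hm 2
  have h4 : (4 : ℝ) ^ h = ((2 : ℝ) ^ h) ^ 2 := by
    rw [← pow_mul, mul_comm, pow_mul]; norm_num
  rw [h4]
  nlinarith [hsq, h3]

end Summit.PneNP.PneNP.Theorems.MonotoneSuffices.ShiftNoGo
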